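import Summits.QuantumFields.BalabanUV.T4Continuum.Support.NE9CurChartOneInstance
import Literature.MathematicalPhysics.QuantumFieldTheory.Balaban1983to89.B11Eq98V0LettersPerLattice
import Literature.MathematicalPhysics.QuantumFieldTheory.Balaban1983to89.B9Thm311DeltaPrimeA

/-!
# NE9CurChartOneInstanceDischarged — THE T23 «ONE INSTANCE» CHART OF `cur U` WITH ITS TWO DISPLAYED SLOTS DISCHARGED WHERE THE TREE CAN: (§1) the
# V₀-group's slot `hqV` of `NE9CurChartOneInstance.cur_chart_exists_oneInstance` REPLACED BY STRUCTURE per lattice (NE9 leaf-01's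
# `B11Eq98V0LettersPerLattice.exists_quadAnalytic_W80_structural`: level-geometry letter Λ, trace-slot letter K, kernel-column letters θ_E ∕ θ₃ all
# CHOSEN at a fixed lattice); (§2) the positivity `hpos` ([B9] Thm 3.11) PROVED at the flat background `U = 1` (the owner's
# `B5Eq172FlatCoercivity.laplaceAofBackground_one_pos`); (§3) the Green's-function letter of `Δπ` and the second trace letter GONE (`GpOfU` at
# leaf-02's `laplacePrimeA_pos`, `τc := τ` made continuous); cell `pub-balaban`, T4-DAG §2 node U3 ∕ §6 NE9, route R2′; NE9 crux-team leaf lineage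
# `b2b-balaban-t4-ne9-formalise-leaf-05`, generation 66; Summits-side sequel of `NE9CurChartOneInstance` under this seat's INTERFACE REQUEST NE9
# (T23) — ADDENDUM; nothing printed asserted

HONEST FRAMING (T4-DAG PAGE 1).  Rung (B)+1 of the FINITE-VOLUME T⁴ programme — NOT infinite volume, NOT a mass gap, NOT the Clay problem.  NE9
(`T4OutputRate.NE9` ∧ `FadingMemory`) is a cell NEW ESTIMATE, NOT PRINTED in [I] = [Balaban1987RG1] (CMP **109**), [II] = [Balaban1988RG2Cluster]
(CMP **116**), and NOT PROVED here («NE9 ⇐ the named binders»; spine PROVED 0∕9).  HONEST DEPENDENCY (cell line, verbatim): continuum YM on T⁴ ⇐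
BetaPertH ∧ nine spine estimates (0/9 proved); BetaPertH ⇐ (D1) ∧ (D4) ∧ CAP+tail; G-an2-4 gates asym, D1 and NE2/3/4.

WHAT THIS FILE PROVES (0 def, 0 sorry, axioms standard).
* §0 `mapT_neg_comp` (`mapT 𝒢 (−(𝒢 ∘L M)) W 0 𝔄 X = −𝒢(M(X + 𝔄) + W(X + 𝔄))`) and **`LJ_add_W80_eq`** (`L_J + W80 = −((HD)′)ᵗJ + W₂ + W₃ + curV0full`
  on `‖A′‖ < a_C`: the Λ-road's total current is (84)–(90) with the FULL `HD` in the first group — no term of (79) is lost; desk question J-79).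
* §1 **`chart_exists_W80_LJ_structural`** (the (115) carriers at `Dc := nabla115 η U₀`, generic `𝒢`, `H₁`, `H`, `C`):
  `NE9CurChartOneInstance.chart_exists_W80_LJ` with the V₀-slot `hqV` REPLACED by STRUCTURE (unitary `U₀` with `‖U₀(b)^{±1}‖ ≤ 1`, tracial
  `*`-compatible continuous trace, `1 ≤ L`, the (31) trace slots `hW`∕`hW'`) — leaf-01's `exists_quadAnalytic_W80_structural` feeds BOTH W-slot
  binders; displayed: the Sect. C data (`RC`, `Prop4Hyp C`, `C` analytic, `0 < a_C`) and the linear-slot smallness `‖𝒢 ∘L L_J‖ < 1`;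
  **`cur_chart_exists_oneInstance_structural`** — AT THE CHAIN's LETTERS (`H(U) = H₁(U) := H1LatticeCLM …`, `𝔊(U) := frakGLatticeCLM …`,
  `C(U) := Cc …`, E162's background data, `hpos` DISPLAYED): `∃ a_C ε_C ε₄ R_b R′ > 0`, the Sect. C `Regime` at `(H(U), C(U), a_C, ε_C)` ∧ (Ψ1)–(Ψ3)
  for `chartHB 𝔊(U) (−(𝔊(U) ∘L LJ ρ τ H(U) C(U) J)) (W80 ρ τ U H(U) C(U) ε_C J Δπ) 0 (A′ ↦ A′ + solA H(U) 0 C(U) 0 ε_C A′) ε₄ H(U)` — ONE `ε_C`, the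
  J-79 term in the Λ-slot, and on the W-side NOTHING displayed but structure and `‖𝔊(U) ∘L L_J‖ < 1`.
* §2 **`cur_chart_exists_oneInstance_flat`** — `cur_chart_exists_oneInstance` AT `U := 1` with `hpos` DISCHARGED (a theorem at the flat background):
  for ANY `J`, `Δπ` (the linear slot is NOT vacuous — `J` is a free letter) the one-instance chart of `cur 1` exists given ONLY the (L3) letters, the
  V₀-slot, `1 ≤ lev₀`, `0 < a`, the flat background-data letters and `‖𝔊(1) ∘L L_J‖ < 1`.
* §3 **`cur_chart_exists_oneInstance_atLetters₂`** — (B)'s `_atLetters` with the Green's-function letter of `Δπ` INSTANTIATED by leaf-01's `GpOfU`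
  ((3.25)) at leaf-02's THEOREM `B9Thm311DeltaPrimeA.laplacePrimeA_pos` (unitary `U`, tracial `τ`, the cell's norming, `0 < a′`) and the current-side
  trace `τc := LinearMap.toContinuousLinearMap τ` — BOTH operator letters of `W` instantiated, ONE trace letter (NE9 leaf-02 g54, ASK-1∕ASK-2).
* §4 **`cur_chart_exists_oneInstance_kernelRoad`** — the same cut on the KERNEL ROAD: `H(U) := HopAd (L:ℝ) η levB lev₀ lev₁ U k_H` (leaf-03's (L4) reading,
  the owner's `cur_chart_exists_of_W` letters) in the T-slot ∕ `W80` ∕ `L_J`, `H₁(U) := H1LatticeCLM …` as the datum map; `k_H` a displayed letter.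
DISGUISE TEST: composition of landed theorems (this lineage's `NE9CurChartOneInstance` + leaf-01's V₀-letters∕`GpOfU` + leaf-02's `Δ′_a(U) > 0` +
leaf-03's `Cc` letters + the owner's chain letters and flat coercivity); no inequality of the series proved (every constant a finite-lattice number; uniformity displayed
elsewhere); `hpos` displayed in §1 (ABSOLUTE RULE), proved only at `U = 1` in §2 (NOT Thm 3.11's perturbation (3.86)); the Λ-road is ONE of T23's two
admissible placements — the chain's road stays the OWNER's decision; not NE9.
References (TYPES ∕ loci only): [Balaban1985Variational] (47) p. 285, (78)–(80) p. 290, (84) p. 290, (85)–(90) p. 291, Prop. 4 (97)–(98) pp. 292–293, Prop. 6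
(116)–(121) p. 295, (143) p. 300; [Balaban1985BackgroundPropagators] (3.26) p. 395, Thm 3.11 p. 416, (3.126) p. 420; [Balaban1984PropagatorsI]
(1.72) p. 30.  Imports `NE9CurChartOneInstance` (this lineage gen 66), `B11Eq98V0LettersPerLattice` (leaf-01) and `B9Thm311DeltaPrimeA` (leaf-02)
ONLY; modifies nothing; no END re-wired.  Value = the desk's T23 object with fewer displayed rows (route R2′ bookkeeping at rung (B)+1), NOT summit progress.
-/

noncomputable section

open Metric Set

namespace Summit.QuantumFields.BalabanUV.T4Continuum.NE9CurChartOneInstanceDischarged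

open Literature.MathematicalPhysics.QuantumFieldTheory.Balaban1983to89
open B11Eq103H1Complex B11Eq115Space B11Eq174Chart
open B11Eq111FrakG (nabla115)
open B13Contraction113 (QuadAnalytic)
open B11Prop6Scheme (Prop4Hyp)
open B9Eq319QprimeTorus (fineP)
open B9SectCLatticeCarrier (Bond)
open B4Sect5Torus (TSite)
open B7Prop1Explicit (U1 Wcx boxVec)
open B9Eq315QTorus (perCfg cornerSite QtorusW laplaceAofBackground)
open B9Eq315QTorusOnto (QtorusW_surjective)
open B11Eq118RegimeRadii (exists_regime_radii)
open B11Eq44COperatorTorus (Cc analyticOnNhd_Cc prop4Hyp_Cc)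
open B11Eq80Current (W80)
open B11Eq79LinearTerm (LJ)
open Summit.QuantumFields.BalabanUV.T4Continuum.NE9CurChartOneInstance (chart_exists_of_RC_linear)

/-! ## §0 What the linear slot computes: `mapT 𝔊 (−𝔊 ∘L L_J) W80 0 𝔄 X = −𝔊((L_J + W80)(X + 𝔄))`, and `L_J + W80` is (84) with the FULL `HD` -/

section LinearSlot

open B11Prop6Scheme (mapT)
open B11Eq90Transpose (transCur)
open B11Eq90V0GroupComposed (curV0full)
open B11Eq80Current (Emap W1 W2 W3)
open B11Eq79LinearTerm (W1_full_eq)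

/-- **THE Λ-SLOT IS `𝒢` APPLIED TO THE SUM OF THE LINEAR TERM AND `W`**: for `Λ := −(𝒢 ∘L M)` and no constant term, the scheme's map reads
`mapT 𝒢 (−(𝒢 ∘L M)) W 0 𝔄 X = −𝒢 (M(X + 𝔄) + W(X + 𝔄))` — (143)'s kept linear term and (116)'s `W`-term under ONE Green's operator.
[cite: Balaban1985Variational, (116) p.295, (143) p.300] -/
theorem mapT_neg_comp {𝒴 𝒵 : Type*} [NormedAddCommGroup 𝒴] [NormedSpace ℂ 𝒴] [NormedAddCommGroup 𝒵] [NormedSpace ℂ 𝒵]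
    (𝒢 : 𝒵 →L[ℂ] 𝒴) (M : 𝒴 →L[ℂ] 𝒵) (W : 𝒴 → 𝒵) (𝔄 X : 𝒴) :
    mapT 𝒢 (-(𝒢.comp M)) W 0 𝔄 X = -𝒢 (M (X + 𝔄) + W (X + 𝔄)) := by
  simp only [mapT, map_zero, neg_zero, zero_add, neg_apply, ContinuousLinearMap.comp_apply, map_add]
  abel

variable {𝔸 : Type*} [NormedRing 𝔸] [NormedAlgebra ℂ 𝔸] [FiniteDimensional ℂ 𝔸] [CompleteSpace 𝔸]
variable {d : ℕ} {Pd : Fin d → ℕ} {L η : ℝ} [Fact (0 < L)] [Fact (0 < η)] {lev₀ : Bond d Pd → ℕ} {κ' : Type*} [Fintype κ']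
  {lev₁ : κ' → ℕ} {Dc : (Bond d Pd → 𝔸) →ₗ[ℂ] (κ' → 𝔸)}
variable {𝒳 : Type*} [NormedAddCommGroup 𝒳] [NormedSpace ℂ 𝒳] [CompleteSpace 𝒳]

omit [CompleteSpace 𝔸] in
/-- **`L_J + W80` IS (84)–(90) WITH THE FULL `HD` IN THE FIRST GROUP**: on `‖A′‖ < a_C`,
`LJ ρ τ H C J A′ + W80 ρ τ U₀ H C ε_C J Δπ A′ = −((HD)′(A′))ᵗJ + W₂(A′) + W₃(A′) + curV0full(A′)` — the Λ-road's total current is the derivative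
of the functional with `−⟨J, HD(A′)⟩` kept IN FULL ((78): `⟨HD(A′), J⟩ = ⟨HC⁽²⁾(A′), J⟩ + ⟨HD₃(A′), J⟩`; this lineage's `B11Eq79LinearTerm.W1_full_eq`),
so feeding `W80` (built on print's `HD₃`) TOGETHER WITH `Λ := −(𝔊 ∘L L_J)` loses no term of (79) when `𝔊` inverts the bare Hessian (desk question J-79).
[cite: Balaban1985Variational, (78)–(79) p.290, (84) p.290, (85) p.291] -/
theorem LJ_add_W80_eq (ρ : (𝔸 →L[ℂ] ℂ) →L[ℂ] 𝔸) (τ : 𝔸 →L[ℂ] ℂ) (U₀ : Bond d Pd → 𝔸ˣ)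
    {H : 𝒳 →L[ℂ] Space115 L η lev₀ lev₁ Dc} {C : Space115 L η lev₀ lev₁ Dc → 𝒳} {b C₂ c₄ aC εC : ℝ}
    (RC : Regime H 0 C b 0 C₂ c₄ 0 aC εC) (hC : Prop4Hyp C C₂ c₄) (J : NegSize L η lev₀ 3 𝔸)
    (Δπ : Space115 L η lev₀ lev₁ Dc →L[ℂ] NegSize L η lev₀ 3 𝔸) {A' : Space115 L η lev₀ lev₁ Dc} (hA' : ‖A'‖ < aC) :
    LJ ρ τ H C J A' + W80 ρ τ U₀ H C εC J Δπ A'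
      = -transCur ρ τ (fderiv ℂ (Emap H C εC) A') J + W2 ρ τ H C εC Δπ A' + W3 ρ τ H C εC Δπ A' + curV0full ρ τ U₀ H C εC A' := by
  rw [W80, W1_full_eq ρ τ RC hC J hA']
  abel

end LinearSlot

/-! ## §1 The V₀-slot DISCHARGED per lattice (NE9 leaf-01's `B11Eq98V0LettersPerLattice`): structure-only W-side -/

section Structural

open B9Eq39Adjoint (posPlaq plaqU)
open B11Eq90V0primeCurrent (Tsh Ucur)
open B11Eq98V0LettersPerLattice (exists_quadAnalytic_W80_structural)

variable {𝔸 : Type*} [NormedRing 𝔸] [NormedAlgebra ℂ 𝔸] [FiniteDimensional ℂ 𝔸] [CompleteSpace 𝔸] [NormOneClass 𝔸] [StarRing 𝔸]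
  [StarModule ℂ 𝔸]
variable {d : ℕ} {Pd : Fin d → ℕ} {L η : ℝ} [Fact (0 < L)] [Fact (0 < η)] {lev₀ : Bond d Pd → ℕ} {lev₁ : Bond d Pd × Fin d → ℕ}
variable {𝒳 : Type*} [NormedAddCommGroup 𝒳] [NormedSpace ℂ 𝒳] [CompleteSpace 𝒳]

/-- **(B) §2 WITH THE V₀-SLOT DISCHARGED**: `NE9CurChartOneInstance.chart_exists_W80_LJ` with `hqV` replaced by NE9 leaf-01's `exists_quadAnalytic_W80_structural` — on the
W-side only STRUCTURE remains (unitary `U₀` with `‖U₀(b)^{±1}‖ ≤ 1`, tracial `*`-compatible continuous trace `τ`, `1 ≤ L`, the (31) trace slots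
`hW`∕`hW'`), besides the Sect. C data `RC`∕`Prop4Hyp C`∕`C` analytic∕`0 < a_C` and the linear-slot smallness `‖𝒢 ∘L L_J‖ < 1`; every constant a
finite-lattice number. [folklore] -/
theorem chart_exists_W80_LJ_structural (ρ : (𝔸 →L[ℂ] ℂ) →L[ℂ] 𝔸) (τ : 𝔸 →L[ℂ] ℂ) (U₀ : Bond d Pd → 𝔸ˣ)
    (𝒢 : NegSize L η lev₀ 3 𝔸 →L[ℂ] Space115 L η lev₀ lev₁ (nabla115 η U₀))
    (hU : ∀ b, (((U₀ b)⁻¹ : 𝔸ˣ) : 𝔸) = star (U₀ b : 𝔸))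
    (hUn : ∀ b, ‖(U₀ b : 𝔸)‖ ≤ 1 ∧ ‖(((U₀ b)⁻¹ : 𝔸ˣ) : 𝔸)‖ ≤ 1)
    (hτ : ∀ a b : 𝔸, τ (a * b) = τ (b * a)) (hτs : ∀ a : 𝔸, τ (star a) = starRingEnd ℂ (τ a)) (hL : 1 ≤ L)
    (hW : ∀ q ∈ posPlaq (TSite d Pd) (Fin d), ∀ Z : 𝔸,
      ‖(τ : 𝔸 →ₗ[ℂ] ℂ) (Z * (plaqU Tsh (Ucur U₀) q.2.1 q.2.2 q.1 : 𝔸))‖ ≤ ‖Z‖)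
    (hW' : ∀ q ∈ posPlaq (TSite d Pd) (Fin d), ∀ Z : 𝔸,
      ‖(τ : 𝔸 →ₗ[ℂ] ℂ) (Z * (((plaqU Tsh (Ucur U₀) q.2.1 q.2.2 q.1)⁻¹ : 𝔸ˣ) : 𝔸))‖ ≤ ‖Z‖)
    {H : 𝒳 →L[ℂ] Space115 L η lev₀ lev₁ (nabla115 η U₀)} {C : Space115 L η lev₀ lev₁ (nabla115 η U₀) → 𝒳} {b C₂ c₄ aC εC : ℝ}
    (RC : Regime H 0 C b 0 C₂ c₄ 0 aC εC) (hC : Prop4Hyp C C₂ c₄)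
    (hCa : AnalyticOnNhd ℂ C {Y : Space115 L η lev₀ lev₁ (nabla115 η U₀) | ‖Y‖ < c₄}) (haC : 0 < aC)
    (J : NegSize L η lev₀ 3 𝔸) (Δπ : Space115 L η lev₀ lev₁ (nabla115 η U₀) →L[ℂ] NegSize L η lev₀ 3 𝔸)
    (hθ : ‖𝒢.comp (LJ ρ τ H C J)‖ < 1)
    {ℬ : Type*} [NormedAddCommGroup ℬ] [NormedSpace ℂ ℬ] (H₁ : ℬ →L[ℂ] Space115 L η lev₀ lev₁ (nabla115 η U₀)) :
    ∃ ε₄ Rb R' : ℝ, 0 < ε₄ ∧ 0 < Rb ∧ 0 < R' ∧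
      DifferentiableOn ℂ (chartHB 𝒢 (-(𝒢.comp (LJ ρ τ H C J))) (W80 ρ τ U₀ H C εC J Δπ) 0
          (fun A' => A' + solA H 0 C 0 εC A') ε₄ H₁) (ball (0 : ℬ) Rb) ∧
      MapsTo (chartHB 𝒢 (-(𝒢.comp (LJ ρ τ H C J))) (W80 ρ τ U₀ H C εC J Δπ) 0
          (fun A' => A' + solA H 0 C 0 εC A') ε₄ H₁) (ball (0 : ℬ) Rb) (ball (0 : Space115 L η lev₀ lev₁ (nabla115 η U₀)) R') ∧
      chartHB 𝒢 (-(𝒢.comp (LJ ρ τ H C J))) (W80 ρ τ U₀ H C εC J Δπ) 0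
          (fun A' => A' + solA H 0 C 0 εC A') ε₄ H₁ 0 = 0 := by
  obtain ⟨R', hR'0, C₄, hC₄, hWq, hWa⟩ :=
    exists_quadAnalytic_W80_structural (L := L) (η := η) (lev₀ := lev₀) (lev₁ := lev₁) ρ τ U₀ hU hUn hτ hτs hL hW hW' RC hC haC J Δπ
  have hΛ : ‖-(𝒢.comp (LJ ρ τ H C J))‖ < 1 := by rwa [norm_neg]
  exact chart_exists_of_RC_linear 𝒢 _ hΛ hWq hC₄ hR'0 hWa RC hCa haC H₁

set_option maxRecDepth 8192 in
/-- **THE T23 OBJECT WITH THE W-SIDE CLOSED DOWN TO STRUCTURE** — `cur_chart_exists_oneInstance` with the V₀-slot `hqV` DISCHARGED by NE9 leaf-01's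
`exists_quadAnalytic_W80_structural` (per-lattice letters Λ (level geometry), K (trace slots), θ_E, θ₃ all chosen): AT THE CHAIN's LETTERS the
one-instance chart of `cur U` — `W80` in the W-slot at the T-slot's own `(H(U), C(U), ε_C)`, `Λ := −(𝔊(U) ∘L L_J)` — exists given `hpos`
(DISPLAYED), E162's background data, the unitarity∕trace STRUCTURE (`hU`, `hUn`, `hτ`, `hτs`, the (31) slots `hW`∕`hW'`) and `‖𝔊(U) ∘L L_J‖ < 1`.
[folklore] -/
theorem cur_chart_exists_oneInstance_structural {d : ℕ} (L : ℕ) [NeZero L] (m : Fin d → ℕ) [∀ i, NeZero (fineP L m i)] (hL : 1 ≤ L)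
    {𝔸 : Type*} [NormedRing 𝔸] [NormedAlgebra ℂ 𝔸] [CompleteSpace 𝔸] [NormOneClass 𝔸] [StarRing 𝔸] [StarModule ℂ 𝔸] [FiniteDimensional ℂ 𝔸]
    {W : Type*} [NormedAddCommGroup W] [InnerProductSpace ℂ W] [FiniteDimensional ℂ W] (φ : W ≃ₗ[ℂ] 𝔸) (τ : 𝔸 →ₗ[ℂ] ℂ)
    {η : ℝ} [Fact (0 < (L : ℝ))] [Fact (0 < η)] {lev₀ : Bond d (fineP L m) → ℕ} {levB : Bond d m → ℕ} (lev₁ : Bond d (fineP L m) × Fin d → ℕ)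
    (hlev : ∀ b, 1 ≤ lev₀ b)
    (U : Bond d (fineP L m) → 𝔸ˣ) {α : ℝ} (hα : α ≤ 1 / 128) (hα1 : α ≤ 1 / 64)
    (hU1 : ∀ (x : B7Prop1Explicit.Site d) (κ : Fin d), perCfg (fineP L m) U x κ ∈ U1 𝔸)
    (hreg : ∀ (y : TSite d m) (κ : Fin d) (r : Fin d → Fin L),
      ‖((Wcx L (perCfg (fineP L m) U) (cornerSite L y) κ (boxVec L r) : 𝔸ˣ) : 𝔸) - 1‖ ≤ α)
    (hαL : 50 * (d + 1) * α * (L : ℝ) ^ d ≤ 1 / 2)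
    {c₀ c₁ : ℝ} [Fact (0 < c₀)] [Fact (0 < c₁)] (a : ℝ)
    (hpos : ∀ x : BondL2K ℂ d (fineP L m) c₀ W, x ≠ 0 →
      0 < RCLike.re (inner ℂ x (laplaceAofBackground L m hL φ U hα1 hU1 hreg τ η (c₀ := c₀) (c₁ := c₁) a x)))
    -- the (L3) letters of `W80`: dualising map, continuous trace, and the STRUCTURE replacing the V₀-slot
    (ρ : (𝔸 →L[ℂ] ℂ) →L[ℂ] 𝔸) (τc : 𝔸 →L[ℂ] ℂ)
    (hU : ∀ b, (((U b)⁻¹ : 𝔸ˣ) : 𝔸) = star (U b : 𝔸))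
    (hUn : ∀ b, ‖(U b : 𝔸)‖ ≤ 1 ∧ ‖(((U b)⁻¹ : 𝔸ˣ) : 𝔸)‖ ≤ 1)
    (hτc : ∀ a b : 𝔸, τc (a * b) = τc (b * a)) (hτs : ∀ a : 𝔸, τc (star a) = starRingEnd ℂ (τc a))
    (hW : ∀ q ∈ posPlaq (TSite d (fineP L m)) (Fin d), ∀ Z : 𝔸,
      ‖(τc : 𝔸 →ₗ[ℂ] ℂ) (Z * (plaqU Tsh (Ucur U) q.2.1 q.2.2 q.1 : 𝔸))‖ ≤ ‖Z‖)
    (hW' : ∀ q ∈ posPlaq (TSite d (fineP L m)) (Fin d), ∀ Z : 𝔸,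
      ‖(τc : 𝔸 →ₗ[ℂ] ℂ) (Z * (((plaqU Tsh (Ucur U) q.2.1 q.2.2 q.1)⁻¹ : 𝔸ˣ) : 𝔸))‖ ≤ ‖Z‖)
    (J : NegSize (L : ℝ) η lev₀ 3 𝔸) (Δπ : Space115 (L : ℝ) η lev₀ lev₁ (nabla115 η U) →L[ℂ] NegSize (L : ℝ) η lev₀ 3 𝔸) :
    let Hc := H1LatticeCLM (lev₀ := lev₀) (levB := levB) φ hpos (QtorusW_surjective L m hL U hα1 hU1 hreg hαL φ) lev₁ (nabla115 η U)
    let Gc := frakGLatticeCLM (lev₀ := lev₀) φ hpos (QtorusW_surjective L m hL U hα1 hU1 hreg hαL φ) lev₁ (nabla115 η U)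
    let Cx := Cc L m η U lev₀ lev₁ (nabla115 η U) levB
    ‖Gc.comp (LJ ρ τc Hc Cx J)‖ < 1 →
    ∃ aC εC ε₄ Rb R' : ℝ, 0 < aC ∧ 0 < εC ∧ 0 < ε₄ ∧ 0 < Rb ∧ 0 < R' ∧
      Regime Hc 0 Cx ‖Hc‖ 0 (2097152 * ((d : ℝ) + 1) ^ 2) (1 / (512 * ((d : ℝ) + 1))) 0 aC εC ∧
      DifferentiableOn ℂ (chartHB Gc (-(Gc.comp (LJ ρ τc Hc Cx J))) (W80 ρ τc U Hc Cx εC J Δπ) 0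
          (fun A' => A' + solA Hc 0 Cx 0 εC A') ε₄ Hc) (ball (0 : NegSize (L : ℝ) η levB 0 𝔸) Rb) ∧
      MapsTo (chartHB Gc (-(Gc.comp (LJ ρ τc Hc Cx J))) (W80 ρ τc U Hc Cx εC J Δπ) 0
          (fun A' => A' + solA Hc 0 Cx 0 εC A') ε₄ Hc) (ball (0 : NegSize (L : ℝ) η levB 0 𝔸) Rb)
          (ball (0 : Space115 (L : ℝ) η lev₀ lev₁ (nabla115 η U)) R') ∧
      chartHB Gc (-(Gc.comp (LJ ρ τc Hc Cx J))) (W80 ρ τc U Hc Cx εC J Δπ) 0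
          (fun A' => A' + solA Hc 0 Cx 0 εC A') ε₄ Hc 0 = 0 := by
  intro Hc Gc Cx hθ
  have hC : Prop4Hyp Cx (2097152 * ((d : ℝ) + 1) ^ 2) (1 / (512 * ((d : ℝ) + 1))) :=
    prop4Hyp_Cc L m η U lev₀ lev₁ (nabla115 η U) levB hL hα hU1 hreg hlev
  have hCa : AnalyticOnNhd ℂ Cx {Y | ‖Y‖ < 1 / (512 * ((d : ℝ) + 1))} :=
    analyticOnNhd_Cc L m η U lev₀ lev₁ (nabla115 η U) levB hL hα hU1 hreg hlev
  obtain ⟨j₁, aC, εC, hj₁, haC, hεC, -, hRC⟩ := exists_regime_radii Hc hC.quadAnalytic (by positivity) (by positivity) one_pos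
  have RC : Regime Hc 0 Cx ‖Hc‖ 0 (2097152 * ((d : ℝ) + 1) ^ 2) (1 / (512 * ((d : ℝ) + 1))) 0 aC εC := hRC 0 le_rfl hj₁.le
  have hL' : (1 : ℝ) ≤ (L : ℝ) := by exact_mod_cast hL
  obtain ⟨ε₄, Rb, R', hε₄, hRb, hR', htriple⟩ :=
    chart_exists_W80_LJ_structural ρ τc U Gc hU hUn hτc hτs hL' hW hW' RC hC hCa haC J Δπ hθ Hc
  exact ⟨aC, εC, ε₄, Rb, R', haC, hεC, hε₄, hRb, hR', RC, htriple⟩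

end Structural

/-! ## §2 The positivity DISCHARGED at the flat background (the owner's `B5Eq172FlatCoercivity`) -/

section Flat

open B5Eq172FlatCoercivity (laplaceAofBackground_one_pos)
open B11Eq63V0GroupCurrent (curV0)
open Summit.QuantumFields.BalabanUV.T4Continuum.NE9CurChartOneInstance (cur_chart_exists_oneInstance)

set_option maxRecDepth 8192 in
/-- **THE T23 OBJECT AT THE FLAT BACKGROUND `U = 1`, `hpos` A THEOREM** — `NE9CurChartOneInstance.cur_chart_exists_oneInstance` at `U := 1` with
its displayed positivity DISCHARGED by the owner's `B5Eq172FlatCoercivity.laplaceAofBackground_one_pos` ([Balaban1984PropagatorsI] (1.72); [B9] p. 416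
«G_□(1) is positive»): for ANY current letter `J` and ANY `Δπ` (the J-79 linear slot `Λ := −(𝔊(1) ∘L L_J)` is NOT vacuous — `J` is free), the
one-instance chart of `cur 1` with `W80 … ε_C J Δπ` in the W-slot at the T-slot's own `(H(1), C(1), ε_C)` exists given ONLY the (L3) letters, the
V₀-slot `hqV`, `1 ≤ lev₀`, `0 < a`, the flat background-data letters and `‖𝔊(1) ∘L L_J‖ < 1` (the two trace letters `τ` ∕ `τc` as in (B) §3:
identified by `τc := LinearMap.toContinuousLinearMap τ`). [folklore] -/
theorem cur_chart_exists_oneInstance_flat {d : ℕ} (L : ℕ) [NeZero L] (m : Fin d → ℕ) [∀ i, NeZero (fineP L m i)] (hL : 1 ≤ L)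
    {𝔸 : Type*} [NormedRing 𝔸] [NormedAlgebra ℂ 𝔸] [CompleteSpace 𝔸] [NormOneClass 𝔸] [StarRing 𝔸] [StarModule ℂ 𝔸] [FiniteDimensional ℂ 𝔸]
    {W : Type*} [NormedAddCommGroup W] [InnerProductSpace ℂ W] [FiniteDimensional ℂ W] (φ : W ≃ₗ[ℂ] 𝔸) (τ : 𝔸 →ₗ[ℂ] ℂ)
    {η : ℝ} [Fact (0 < (L : ℝ))] [Fact (0 < η)] {lev₀ : Bond d (fineP L m) → ℕ} {levB : Bond d m → ℕ} (lev₁ : Bond d (fineP L m) × Fin d → ℕ)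
    (hlev : ∀ b, 1 ≤ lev₀ b) {α : ℝ} (hα : α ≤ 1 / 128) (hα1 : α ≤ 1 / 64)
    (hU1 : ∀ (x : B7Prop1Explicit.Site d) (κ : Fin d), perCfg (fineP L m) (fun _ : Bond d (fineP L m) => (1 : 𝔸ˣ)) x κ ∈ U1 𝔸)
    (hreg : ∀ (y : TSite d m) (κ : Fin d) (r : Fin d → Fin L),
      ‖((Wcx L (perCfg (fineP L m) (fun _ : Bond d (fineP L m) => (1 : 𝔸ˣ))) (cornerSite L y) κ (boxVec L r) : 𝔸ˣ) : 𝔸) - 1‖ ≤ α)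
    (hαL : 50 * (d + 1) * α * (L : ℝ) ^ d ≤ 1 / 2)
    {c₀ c₁ : ℝ} [Fact (0 < c₀)] [Fact (0 < c₁)] {a : ℝ} (ha : 0 < a)
    (ρ : (𝔸 →L[ℂ] ℂ) →L[ℂ] 𝔸) (τc : 𝔸 →L[ℂ] ℂ) {CV RV : ℝ} (hCV : 0 ≤ CV) (hRV : 0 < RV)
    (hqV : ∀ Y : Space115 (L : ℝ) η lev₀ lev₁ (nabla115 η (fun _ : Bond d (fineP L m) => (1 : 𝔸ˣ))), ‖Y‖ < RV →
      ‖curV0 (lev₁ := lev₁) (Dc := nabla115 η (fun _ : Bond d (fineP L m) => (1 : 𝔸ˣ))) ρ τc (fun _ => 1) Y‖ ≤ CV * ‖Y‖ ^ 2)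
    (J : NegSize (L : ℝ) η lev₀ 3 𝔸)
    (Δπ : Space115 (L : ℝ) η lev₀ lev₁ (nabla115 η (fun _ : Bond d (fineP L m) => (1 : 𝔸ˣ))) →L[ℂ] NegSize (L : ℝ) η lev₀ 3 𝔸) :
    let hpos := laplaceAofBackground_one_pos L m hL φ (c₀ := c₀) (c₁ := c₁) τ (ne_of_gt (Fact.out : 0 < η)) hα1 hU1 hreg ha
    let Hc := H1LatticeCLM (lev₀ := lev₀) (levB := levB) φ hpos
      (QtorusW_surjective L m hL (fun _ : Bond d (fineP L m) => (1 : 𝔸ˣ)) hα1 hU1 hreg hαL φ) lev₁ (nabla115 η (fun _ : Bond d (fineP L m) => (1 : 𝔸ˣ)))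
    let Gc := frakGLatticeCLM (lev₀ := lev₀) φ hpos
      (QtorusW_surjective L m hL (fun _ : Bond d (fineP L m) => (1 : 𝔸ˣ)) hα1 hU1 hreg hαL φ) lev₁ (nabla115 η (fun _ : Bond d (fineP L m) => (1 : 𝔸ˣ)))
    let Cx := Cc L m η (fun _ : Bond d (fineP L m) => (1 : 𝔸ˣ)) lev₀ lev₁ (nabla115 η (fun _ : Bond d (fineP L m) => (1 : 𝔸ˣ))) levB
    ‖Gc.comp (LJ ρ τc Hc Cx J)‖ < 1 →
    ∃ aC εC ε₄ Rb R' : ℝ, 0 < aC ∧ 0 < εC ∧ 0 < ε₄ ∧ 0 < Rb ∧ 0 < R' ∧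
      Regime Hc 0 Cx ‖Hc‖ 0 (2097152 * ((d : ℝ) + 1) ^ 2) (1 / (512 * ((d : ℝ) + 1))) 0 aC εC ∧
      DifferentiableOn ℂ (chartHB Gc (-(Gc.comp (LJ ρ τc Hc Cx J))) (W80 ρ τc (fun _ => 1) Hc Cx εC J Δπ) 0
          (fun A' => A' + solA Hc 0 Cx 0 εC A') ε₄ Hc) (ball (0 : NegSize (L : ℝ) η levB 0 𝔸) Rb) ∧
      MapsTo (chartHB Gc (-(Gc.comp (LJ ρ τc Hc Cx J))) (W80 ρ τc (fun _ => 1) Hc Cx εC J Δπ) 0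
          (fun A' => A' + solA Hc 0 Cx 0 εC A') ε₄ Hc) (ball (0 : NegSize (L : ℝ) η levB 0 𝔸) Rb)
          (ball (0 : Space115 (L : ℝ) η lev₀ lev₁ (nabla115 η (fun _ : Bond d (fineP L m) => (1 : 𝔸ˣ)))) R') ∧
      chartHB Gc (-(Gc.comp (LJ ρ τc Hc Cx J))) (W80 ρ τc (fun _ => 1) Hc Cx εC J Δπ) 0
          (fun A' => A' + solA Hc 0 Cx 0 εC A') ε₄ Hc 0 = 0 := by
  intro hpos Hc Gc Cx hθ
  exact cur_chart_exists_oneInstance L m hL φ τ lev₁ hlev (fun _ => 1) hα hα1 hU1 hreg hαL a hpos ρ τc hCV hRV hqV J Δπ hθ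

end Flat

/-! ## §3 BOTH operator letters of `W` instantiated with NO free Green's-function letter and ONE trace (NE9 leaf-02's `B9Thm311DeltaPrimeA`) -/

section AtLettersClosed

open scoped InnerProductSpace
open B9Thm311DeltaPrimeA (laplacePrimeA_pos)
open B9Eq3119DeltaPiCarrier (GpOfU)
open B11Eq90CurrentAtLetters (W80L)
open B11Eq98CurrentSlot (Jcur)
open B11Eq63V0GroupCurrent (curV0)
open Summit.QuantumFields.BalabanUV.T4Continuum.NE9CurChartOneInstance (cur_chart_exists_oneInstance_atLetters)

set_option maxRecDepth 8192 in
/-- **THE T23 OBJECT AT THE LETTERS WITH `G′ := (Δ′_a(U))⁻¹` CONSTRUCTED AND ONE TRACE** — (B)'s `cur_chart_exists_oneInstance_atLetters` with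
(i) the Green's-function letter of `Δπ` INSTANTIATED by NE9 leaf-01's `GpOfU` ([Balaban1985BackgroundPropagators] (3.25)) whose positivity `hpos′`
is NE9 leaf-02's THEOREM `B9Thm311DeltaPrimeA.laplacePrimeA_pos` (unitary `U`, tracial `τ`, the cell's norming `⟪φ⁻¹X, φ⁻¹Y⟫ = τ(X*Y)`, `η ≠ 0`,
`0 < a′`), and (ii) the current-side trace `τc := LinearMap.toContinuousLinearMap τ` — print's ONE `tr` (NE9 leaf-02 g54, ASK-1∕ASK-2): the W-slot is
`W80L L m φ U (GpOfU …) lev₁ (nabla115 η U) ρ τc H(U) C(U) ε_C`, `J := Jcur U`, `Λ := −(𝔊(U) ∘L L_{Jcur U})`; displayed: `hpos` (the Hessian's,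
ABSOLUTE RULE), E162's data, `ρ`, the V₀-slot `hqV`, `0 < a′`, the structure `hτ₂`∕`hφ`∕`hU`, and `‖𝔊(U) ∘L L_J‖ < 1`. [folklore] -/
theorem cur_chart_exists_oneInstance_atLetters₂ {d : ℕ} (L : ℕ) [NeZero L] (m : Fin d → ℕ) [∀ i, NeZero (fineP L m i)] (hL : 1 ≤ L)
    {𝔸 : Type*} [NormedRing 𝔸] [NormedAlgebra ℂ 𝔸] [CompleteSpace 𝔸] [NormOneClass 𝔸] [StarRing 𝔸] [StarModule ℂ 𝔸] [FiniteDimensional ℂ 𝔸]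
    {W : Type*} [NormedAddCommGroup W] [InnerProductSpace ℂ W] [FiniteDimensional ℂ W] (φ : W ≃ₗ[ℂ] 𝔸) (τ : 𝔸 →ₗ[ℂ] ℂ)
    {η : ℝ} [Fact (0 < (L : ℝ))] [Fact (0 < η)] {lev₀ : Bond d (fineP L m) → ℕ} {levB : Bond d m → ℕ} (lev₁ : Bond d (fineP L m) × Fin d → ℕ)
    (hlev : ∀ b, 1 ≤ lev₀ b)
    (U : Bond d (fineP L m) → 𝔸ˣ) {α : ℝ} (hα : α ≤ 1 / 128) (hα1 : α ≤ 1 / 64)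
    (hU1 : ∀ (x : B7Prop1Explicit.Site d) (κ : Fin d), perCfg (fineP L m) U x κ ∈ U1 𝔸)
    (hreg : ∀ (y : TSite d m) (κ : Fin d) (r : Fin d → Fin L),
      ‖((Wcx L (perCfg (fineP L m) U) (cornerSite L y) κ (boxVec L r) : 𝔸ˣ) : 𝔸) - 1‖ ≤ α)
    (hαL : 50 * (d + 1) * α * (L : ℝ) ^ d ≤ 1 / 2)
    {c₀ c₁ : ℝ} [Fact (0 < c₀)] [Fact (0 < c₁)] (a : ℝ)
    (hpos : ∀ x : BondL2K ℂ d (fineP L m) c₀ W, x ≠ 0 →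
      0 < RCLike.re (inner ℂ x (laplaceAofBackground L m hL φ U hα1 hU1 hreg τ η (c₀ := c₀) (c₁ := c₁) a x)))
    -- the structure making `Δ′_a(U) > 0` a theorem (leaf-02), and the penalty weight `a′`
    (hτ₂ : ∀ X Y : 𝔸, τ (X * Y) = τ (Y * X)) (hφ : ∀ X Y : 𝔸, ⟪φ.symm X, φ.symm Y⟫_ℂ = τ (star X * Y))
    (hU : ∀ b, star (U b : 𝔸) = ((U b)⁻¹ : 𝔸ˣ)) {a' : ℝ} (ha' : 0 < a')
    -- the remaining (L3) letters: the dualising map and the V₀-slot (at `τc := τ` made continuous)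
    (ρ : (𝔸 →L[ℂ] ℂ) →L[ℂ] 𝔸) {CV RV : ℝ} (hCV : 0 ≤ CV) (hRV : 0 < RV)
    (hqV : ∀ Y : Space115 (L : ℝ) η lev₀ lev₁ (nabla115 η U), ‖Y‖ < RV →
      ‖curV0 (lev₁ := lev₁) (Dc := nabla115 η U) ρ (LinearMap.toContinuousLinearMap τ) U Y‖ ≤ CV * ‖Y‖ ^ 2) :
    let hpos' := laplacePrimeA_pos L m φ η U a' (c₁ := c₁) τ hτ₂ hφ hU (ne_of_gt (Fact.out : 0 < η)) ha'
    let Hc := H1LatticeCLM (lev₀ := lev₀) (levB := levB) φ hpos (QtorusW_surjective L m hL U hα1 hU1 hreg hαL φ) lev₁ (nabla115 η U)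
    let Gc := frakGLatticeCLM (lev₀ := lev₀) φ hpos (QtorusW_surjective L m hL U hα1 hU1 hreg hαL φ) lev₁ (nabla115 η U)
    let Cx := Cc L m η U lev₀ lev₁ (nabla115 η U) levB
    ‖Gc.comp (LJ ρ (LinearMap.toContinuousLinearMap τ) Hc Cx (Jcur (L := (L : ℝ)) (η := η) (lev₀ := lev₀) U))‖ < 1 →
    ∃ aC εC ε₄ Rb R' : ℝ, 0 < aC ∧ 0 < εC ∧ 0 < ε₄ ∧ 0 < Rb ∧ 0 < R' ∧
      Regime Hc 0 Cx ‖Hc‖ 0 (2097152 * ((d : ℝ) + 1) ^ 2) (1 / (512 * ((d : ℝ) + 1))) 0 aC εC ∧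
      DifferentiableOn ℂ (chartHB Gc (-(Gc.comp (LJ ρ (LinearMap.toContinuousLinearMap τ) Hc Cx (Jcur (L := (L : ℝ)) (η := η) (lev₀ := lev₀) U))))
          (W80L L m φ (Lr := (L : ℝ)) (η := η) U (GpOfU L m φ η U a' (c₀ := c₀) (c₁ := c₁) hpos') lev₁ (nabla115 η U) ρ
            (LinearMap.toContinuousLinearMap τ) Hc Cx εC) 0
          (fun A' => A' + solA Hc 0 Cx 0 εC A') ε₄ Hc) (ball (0 : NegSize (L : ℝ) η levB 0 𝔸) Rb) ∧
      MapsTo (chartHB Gc (-(Gc.comp (LJ ρ (LinearMap.toContinuousLinearMap τ) Hc Cx (Jcur (L := (L : ℝ)) (η := η) (lev₀ := lev₀) U))))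
          (W80L L m φ (Lr := (L : ℝ)) (η := η) U (GpOfU L m φ η U a' (c₀ := c₀) (c₁ := c₁) hpos') lev₁ (nabla115 η U) ρ
            (LinearMap.toContinuousLinearMap τ) Hc Cx εC) 0
          (fun A' => A' + solA Hc 0 Cx 0 εC A') ε₄ Hc) (ball (0 : NegSize (L : ℝ) η levB 0 𝔸) Rb)
          (ball (0 : Space115 (L : ℝ) η lev₀ lev₁ (nabla115 η U)) R') ∧
      chartHB Gc (-(Gc.comp (LJ ρ (LinearMap.toContinuousLinearMap τ) Hc Cx (Jcur (L := (L : ℝ)) (η := η) (lev₀ := lev₀) U))))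
          (W80L L m φ (Lr := (L : ℝ)) (η := η) U (GpOfU L m φ η U a' (c₀ := c₀) (c₁ := c₁) hpos') lev₁ (nabla115 η U) ρ
            (LinearMap.toContinuousLinearMap τ) Hc Cx εC) 0
          (fun A' => A' + solA Hc 0 Cx 0 εC A') ε₄ Hc 0 = 0 := by
  intro hpos' Hc Gc Cx hθ
  exact cur_chart_exists_oneInstance_atLetters L m hL φ τ lev₁ hlev U hα hα1 hU1 hreg hαL a hpos ρ (LinearMap.toContinuousLinearMap τ)
    hCV hRV hqV (GpOfU L m φ η U a' (c₀ := c₀) (c₁ := c₁) hpos') hθ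

end AtLettersClosed

/-! ## §4 The kernel-road species: `H := HopAd … k_H` in the T-slot ∕ `W80` ∕ `L_J` (the owner's `cur_chart_exists_of_W` letters), `H₁ := H1LatticeCLM` -/

section KernelRoad

open B11Eq45HOperator (HopAd)
open B11Eq63V0GroupCurrent (curV0)
open Summit.QuantumFields.BalabanUV.T4Continuum.NE9CurChartOneInstance (chart_exists_W80_LJ)

set_option maxRecDepth 8192 in
/-- **THE T23 OBJECT ON THE KERNEL ROAD** — the same one-instance cut at the letters of the owner's `cur_chart_exists_of_W` (NE9 leaf-03's (L4)
kernel reading of [Balaban1985Variational] (45): `H(U) := HopAd (L:ℝ) η levB lev₀ lev₁ U k_H` with the kernel DATUM `k_H`, in the T-slot, in `W80` and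
in `L_J`; the chart's datum map `H₁(U) := H1LatticeCLM …`; `𝔊(U) := frakGLatticeCLM …`; `C(U) := Cc …`): the Sect. C radii are chosen FIRST at
`(HopAd … k_H, Cc …)` per lattice (`exists_regime_radii`, leaf-03's `prop4Hyp_Cc`), THEN `W := W80 … ε_C …` at THAT `ε_C` and `Λ := −(𝔊(U) ∘L L_J)`.
Displayed: `hpos`, E162's data, the (L3) letters + `hqV`, the kernel letter `k_H`, `‖𝔊(U) ∘L L_J‖ < 1`.  Either species (this, or §3 of (B) at
`H := H1LatticeCLM`) is the desk's T23 object (PRICING-NE9 v31 §D (3)). [folklore] -/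
theorem cur_chart_exists_oneInstance_kernelRoad {d : ℕ} (L : ℕ) [NeZero L] (m : Fin d → ℕ) [∀ i, NeZero (fineP L m i)] (hL : 1 ≤ L)
    {𝔸 : Type*} [NormedRing 𝔸] [NormedAlgebra ℂ 𝔸] [CompleteSpace 𝔸] [NormOneClass 𝔸] [StarRing 𝔸] [StarModule ℂ 𝔸] [FiniteDimensional ℂ 𝔸]
    {W : Type*} [NormedAddCommGroup W] [InnerProductSpace ℂ W] [FiniteDimensional ℂ W] (φ : W ≃ₗ[ℂ] 𝔸) (τ : 𝔸 →ₗ[ℂ] ℂ)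
    {η : ℝ} [Fact (0 < (L : ℝ))] [Fact (0 < η)] {lev₀ : Bond d (fineP L m) → ℕ} {levB : Bond d m → ℕ} (lev₁ : Bond d (fineP L m) × Fin d → ℕ)
    (hlev : ∀ b, 1 ≤ lev₀ b)
    (U : Bond d (fineP L m) → 𝔸ˣ) {α : ℝ} (hα : α ≤ 1 / 128) (hα1 : α ≤ 1 / 64)
    (hU1 : ∀ (x : B7Prop1Explicit.Site d) (κ : Fin d), perCfg (fineP L m) U x κ ∈ U1 𝔸)
    (hreg : ∀ (y : TSite d m) (κ : Fin d) (r : Fin d → Fin L),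
      ‖((Wcx L (perCfg (fineP L m) U) (cornerSite L y) κ (boxVec L r) : 𝔸ˣ) : 𝔸) - 1‖ ≤ α)
    (hαL : 50 * (d + 1) * α * (L : ℝ) ^ d ≤ 1 / 2)
    {c₀ c₁ : ℝ} [Fact (0 < c₀)] [Fact (0 < c₁)] (a : ℝ)
    (hpos : ∀ x : BondL2K ℂ d (fineP L m) c₀ W, x ≠ 0 →
      0 < RCLike.re (inner ℂ x (laplaceAofBackground L m hL φ U hα1 hU1 hreg τ η (c₀ := c₀) (c₁ := c₁) a x)))
    (kH : Bond d (fineP L m) → Bond d m → (𝔸 →L[ℂ] 𝔸))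
    (ρ : (𝔸 →L[ℂ] ℂ) →L[ℂ] 𝔸) (τc : 𝔸 →L[ℂ] ℂ) {CV RV : ℝ} (hCV : 0 ≤ CV) (hRV : 0 < RV)
    (hqV : ∀ Y : Space115 (L : ℝ) η lev₀ lev₁ (nabla115 η U), ‖Y‖ < RV →
      ‖curV0 (lev₁ := lev₁) (Dc := nabla115 η U) ρ τc U Y‖ ≤ CV * ‖Y‖ ^ 2)
    (J : NegSize (L : ℝ) η lev₀ 3 𝔸) (Δπ : Space115 (L : ℝ) η lev₀ lev₁ (nabla115 η U) →L[ℂ] NegSize (L : ℝ) η lev₀ 3 𝔸) :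
    let Hk := HopAd (L : ℝ) η levB lev₀ lev₁ U kH
    let H₁ := H1LatticeCLM (lev₀ := lev₀) (levB := levB) φ hpos (QtorusW_surjective L m hL U hα1 hU1 hreg hαL φ) lev₁ (nabla115 η U)
    let Gc := frakGLatticeCLM (lev₀ := lev₀) φ hpos (QtorusW_surjective L m hL U hα1 hU1 hreg hαL φ) lev₁ (nabla115 η U)
    let Cx := Cc L m η U lev₀ lev₁ (nabla115 η U) levB
    ‖Gc.comp (LJ ρ τc Hk Cx J)‖ < 1 →
    ∃ aC εC ε₄ Rb R' : ℝ, 0 < aC ∧ 0 < εC ∧ 0 < ε₄ ∧ 0 < Rb ∧ 0 < R' ∧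
      Regime Hk 0 Cx ‖Hk‖ 0 (2097152 * ((d : ℝ) + 1) ^ 2) (1 / (512 * ((d : ℝ) + 1))) 0 aC εC ∧
      DifferentiableOn ℂ (chartHB Gc (-(Gc.comp (LJ ρ τc Hk Cx J))) (W80 ρ τc U Hk Cx εC J Δπ) 0
          (fun A' => A' + solA Hk 0 Cx 0 εC A') ε₄ H₁) (ball (0 : NegSize (L : ℝ) η levB 0 𝔸) Rb) ∧
      MapsTo (chartHB Gc (-(Gc.comp (LJ ρ τc Hk Cx J))) (W80 ρ τc U Hk Cx εC J Δπ) 0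
          (fun A' => A' + solA Hk 0 Cx 0 εC A') ε₄ H₁) (ball (0 : NegSize (L : ℝ) η levB 0 𝔸) Rb)
          (ball (0 : Space115 (L : ℝ) η lev₀ lev₁ (nabla115 η U)) R') ∧
      chartHB Gc (-(Gc.comp (LJ ρ τc Hk Cx J))) (W80 ρ τc U Hk Cx εC J Δπ) 0
          (fun A' => A' + solA Hk 0 Cx 0 εC A') ε₄ H₁ 0 = 0 := by
  intro Hk H₁ Gc Cx hθ
  have hC : Prop4Hyp Cx (2097152 * ((d : ℝ) + 1) ^ 2) (1 / (512 * ((d : ℝ) + 1))) :=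
    prop4Hyp_Cc L m η U lev₀ lev₁ (nabla115 η U) levB hL hα hU1 hreg hlev
  have hCa : AnalyticOnNhd ℂ Cx {Y | ‖Y‖ < 1 / (512 * ((d : ℝ) + 1))} :=
    analyticOnNhd_Cc L m η U lev₀ lev₁ (nabla115 η U) levB hL hα hU1 hreg hlev
  obtain ⟨j₁, aC, εC, hj₁, haC, hεC, -, hRC⟩ := exists_regime_radii Hk hC.quadAnalytic (by positivity) (by positivity) one_pos
  have RC : Regime Hk 0 Cx ‖Hk‖ 0 (2097152 * ((d : ℝ) + 1) ^ 2) (1 / (512 * ((d : ℝ) + 1))) 0 aC εC := hRC 0 le_rfl hj₁.le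
  obtain ⟨ε₄, Rb, R', hε₄, hRb, hR', htriple⟩ := chart_exists_W80_LJ Gc ρ τc U hCV hRV hqV RC hC hCa haC J Δπ hθ H₁
  exact ⟨aC, εC, ε₄, Rb, R', haC, hεC, hε₄, hRb, hR', RC, htriple⟩

end KernelRoad

end Summit.QuantumFields.BalabanUV.T4Continuum.NE9CurChartOneInstanceDischarged

end
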